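import Mathlib
import Literature.Analysis.OperatorTheory.ContractiveDetComplexity
import HarnessLib

/-!
# Crux `PriceOfContractivity` (stmt-ValiantsHypothesis-10583), line `birth` — stub
# `stub_sameSize_singleColour`: the one-colour Sylvester pencil

Route `ValiantsHypothesis/ContractivityPrice`, crux K1
(`Summit.ValiantsHypothesis.ValiantsHypothesis.Theses.ContractivityPrice.PriceOfContractivity`).
This file proves the registered partial case `stub_sameSize_singleColour` of the line
"budget, then halving": a Sylvester pencil `1 + diag (X ∘ κ) · K₀` of size `R` whose colouring `κ`
is CONSTANT and whose determinant has no zero on the closed polydisc of radius `2` is re-realized,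
at the same size and with the same colouring, by a matrix of operator norm `≤ 1/2`.

## Proof

With one colour `x = X (κ i)` the pencil is `1 + x K₀`. Over `ℂ` the characteristic polynomial of
`K₀` splits, `charpoly K₀ = ∏ᵢ (X - λᵢ)` for an enumeration `λ : Fin R → ℂ` of the eigenvalues
(`exists_charpoly_eq_prod_X_sub_C`), whence the scalar identity
`det (1 + t K₀) = (-t)^R · charpoly K₀ (-t⁻¹) = ∏ᵢ (1 + t λᵢ)` for every `t : ℂ`
(`det_one_add_smul_eq_prod`). Evaluating the zero-freeness hypothesis at the constant point
`z ≡ t`, `|t| ≤ 2`, gives `∏ᵢ (1 + t λᵢ) ≠ 0`, so `|λᵢ| < 1/2` (else `t = -λᵢ⁻¹` kills a factor).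
The witness is `K₁ = diag λ`, `κ₁ = κ`: its pencil is diagonal with determinant `∏ᵢ (1 + x λᵢ)`,
which agrees with `det (1 + x K₀)` at every point of `σ → ℂ`, hence as polynomials
(`MvPolynomial.funext`, `ℂ` infinite); and `‖diag λ‖_op = maxᵢ |λᵢ| ≤ 1/2`
(`Matrix.l2_opNorm_diagonal`).

All of this is standard linear algebra (eigenvalues of a complex matrix; the spectral radius of a
diagonal matrix is its norm); no source beyond folklore.
-/

noncomputable section

namespace Summit.ValiantsHypothesis.ValiantsHypothesis.Theorems.PriceOfContractivity.SingleColour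

open Matrix
open Literature.Analysis.OperatorTheory (eval_det_one_add_diagonal_mul_map_C)

/-- **Eigenvalue enumeration.** Over `ℂ` the characteristic polynomial of an `R × R` matrix
splits into `R` linear factors: `charpoly K = ∏_{i < R} (X - λ i)` for some `λ : Fin R → ℂ`
(the roots listed with multiplicity). [folklore] -/
theorem exists_charpoly_eq_prod_X_sub_C {R : ℕ} (K : Matrix (Fin R) (Fin R) ℂ) :
    ∃ lam : Fin R → ℂ, K.charpoly = ∏ i, (Polynomial.X - Polynomial.C (lam i)) := by
  have hsplit : K.charpoly.Splits := IsAlgClosed.splits _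
  set l : List ℂ := K.charpoly.roots.toList with hl
  have hlen : l.length = R := by
    rw [hl, Multiset.length_toList, ← hsplit.natDegree_eq_card_roots,
      Matrix.charpoly_natDegree_eq_dim, Fintype.card_fin]
  refine ⟨fun i => l[i.1]'(hlen.symm ▸ i.2), ?_⟩
  calc K.charpoly = (K.charpoly.roots.map (Polynomial.X - Polynomial.C ·)).prod :=
        hsplit.eq_prod_roots_of_monic K.charpoly_monic
    _ = (l.map (Polynomial.X - Polynomial.C ·)).prod := by
        rw [hl, ← Multiset.prod_coe, ← Multiset.map_coe, Multiset.coe_toList]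
    _ = ∏ i : Fin l.length, (Polynomial.X - Polynomial.C l[i.1]) :=
        (Fin.prod_univ_fun_getElem l _).symm
    _ = ∏ i : Fin R, (Polynomial.X - Polynomial.C (l[i.1]'(hlen.symm ▸ i.2))) :=
        Fintype.prod_equiv (finCongr hlen) _ _ fun _ => rfl

/-- **`det (1 + t K) = ∏ᵢ (1 + t λᵢ)`** over the eigenvalues `λ` of `K` (with multiplicity): for
`t ≠ 0`, `1 + t K = (-t) · ((-t⁻¹) · 1 - K)`, so `det (1 + t K) = (-t)^R · charpoly K (-t⁻¹)`.
[folklore] -/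
theorem det_one_add_smul_eq_prod {R : ℕ} (K : Matrix (Fin R) (Fin R) ℂ) {lam : Fin R → ℂ}
    (hK : K.charpoly = ∏ i, (Polynomial.X - Polynomial.C (lam i))) (t : ℂ) :
    (1 + t • K).det = ∏ i, (1 + t * lam i) := by
  rcases eq_or_ne t 0 with rfl | ht
  · simp
  have hmat : (1 : Matrix (Fin R) (Fin R) ℂ) + t • K =
      (-t) • (Matrix.scalar (Fin R) (-t⁻¹) - K) := by
    ext i j
    simp only [Matrix.add_apply, Matrix.smul_apply, Matrix.sub_apply, Matrix.scalar_apply,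
      Matrix.one_apply, Matrix.diagonal_apply, smul_eq_mul]
    split_ifs with h
    · have h1 : t * t⁻¹ = 1 := mul_inv_cancel₀ ht
      linear_combination (-1 : ℂ) * h1
    · ring
  have heval : (Matrix.scalar (Fin R) (-t⁻¹) - K).det = ∏ i, (-t⁻¹ - lam i) := by
    rw [← Matrix.eval_charpoly, hK, Polynomial.eval_prod]
    simp
  calc ((1 : Matrix (Fin R) (Fin R) ℂ) + t • K).det
        = (-t) ^ Fintype.card (Fin R) * ∏ i, (-t⁻¹ - lam i) := by rw [hmat, det_smul, heval]
    _ = ∏ i : Fin R, (-t) * (-t⁻¹ - lam i) := by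
        rw [Finset.prod_mul_distrib, Finset.prod_const, Finset.card_univ]
    _ = ∏ i, (1 + t * lam i) := Finset.prod_congr rfl fun i _ => by
        have h1 : t * t⁻¹ = 1 := mul_inv_cancel₀ ht
        linear_combination h1

/-- **The one-colour pencil determinant.** If `charpoly K₀ = ∏ᵢ (X - λᵢ)` then, for every scalar
`t`, `det (1 + diag (t, …, t) · K₀) = ∏ᵢ (1 + t λᵢ)`. [folklore] -/
theorem det_one_add_diagonal_const_mul_eq_prod {R : ℕ} (K : Matrix (Fin R) (Fin R) ℂ)
    {lam : Fin R → ℂ} (hK : K.charpoly = ∏ i, (Polynomial.X - Polynomial.C (lam i))) (t : ℂ) :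
    (1 + Matrix.diagonal (fun _ : Fin R => t) * K).det = ∏ i, (1 + t * lam i) := by
  rw [← Matrix.smul_eq_diagonal_mul]
  exact det_one_add_smul_eq_prod K hK t

/-- **The diagonal pencil determinant.** `det (1 + diag (t, …, t) · diag λ) = ∏ᵢ (1 + t λᵢ)`.
[folklore] -/
theorem det_one_add_diagonal_const_mul_diagonal {R : ℕ} (lam : Fin R → ℂ) (t : ℂ) :
    (1 + Matrix.diagonal (fun _ : Fin R => t) * Matrix.diagonal lam).det = ∏ i, (1 + t * lam i) := by
  rw [Matrix.diagonal_mul_diagonal, ← Matrix.diagonal_one, Matrix.diagonal_add, Matrix.det_diagonal]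

/-- **Eigenvalue bound from zero-freeness.** If `∏ᵢ (1 + t λᵢ) ≠ 0` for all `|t| ≤ 2` then every
`|λᵢ| < 1/2` (otherwise `t = -λᵢ⁻¹` has `|t| ≤ 2` and kills the `i`-th factor). [folklore] -/
theorem norm_lt_half_of_prod_ne_zero {R : ℕ} {lam : Fin R → ℂ}
    (h : ∀ t : ℂ, ‖t‖ ≤ 2 → ∏ i, (1 + t * lam i) ≠ 0) (i : Fin R) : ‖lam i‖ < 1 / 2 := by
  by_contra! hi
  have hne : lam i ≠ 0 := by
    intro h0
    rw [h0, norm_zero] at hi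
    norm_num at hi
  have ht : ‖-(lam i)⁻¹‖ ≤ 2 := by
    rw [norm_neg, norm_inv]
    calc ‖lam i‖⁻¹ ≤ (1 / 2)⁻¹ := inv_anti₀ (by norm_num) hi
      _ = 2 := by norm_num
  refine h _ ht (Finset.prod_eq_zero (Finset.mem_univ i) ?_)
  rw [neg_mul, inv_mul_cancel₀ hne, add_neg_cancel]

open scoped Matrix.Norms.L2Operator in
/-- **The operator norm of a diagonal matrix** is at most `r` as soon as every diagonal entry has
modulus `≤ r` (`‖diag λ‖_op = maxᵢ |λᵢ|`, `Matrix.l2_opNorm_diagonal`). [folklore] -/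
theorem norm_toEuclideanCLM_diagonal_le {R : ℕ} (lam : Fin R → ℂ) {r : ℝ} (hr : 0 ≤ r)
    (h : ∀ i, ‖lam i‖ ≤ r) : ‖Matrix.toEuclideanCLM (𝕜 := ℂ) (Matrix.diagonal lam)‖ ≤ r := by
  rw [Matrix.l2_opNorm_toEuclideanCLM, Matrix.l2_opNorm_diagonal]
  exact (pi_norm_le_iff_of_nonneg hr).mpr h

/-- **Partial case (one colour) of crux `PriceOfContractivity`, line `birth`.** If every row of
the Sylvester pencil `1 + diag (X ∘ κ) · K₀` carries the same variable `x`, then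
`det (1 + x K₀) = ∏ᵢ (1 + λᵢ x)` over the eigenvalues of `K₀`, zero-freeness on `|x| ≤ 2` forces
`|λᵢ| < 1/2`, and `K₁ = diag λ` (same size, same colouring) re-realizes the determinant with
`‖K₁‖_op ≤ 1/2`. [folklore] -/
theorem stub_sameSize_singleColour :
    ∀ (R : ℕ) {σ : Type} (K₀ : Matrix (Fin R) (Fin R) ℂ) (κ : Fin R → σ),
      (∀ i j, κ i = κ j) →
      (∀ z : σ → ℂ, (∀ j, ‖z j‖ ≤ 2) → MvPolynomial.eval z (1 + Matrix.diagonal (fun i => MvPolynomial.X (κ i)) * K₀.map (fun a : ℂ => (MvPolynomial.C a : MvPolynomial σ ℂ))).det ≠ 0) →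
      ∃ (K₁ : Matrix (Fin R) (Fin R) ℂ) (κ₁ : Fin R → σ),
        ‖Matrix.toEuclideanCLM (𝕜 := ℂ) K₁‖ ≤ 1 / 2 ∧
        (1 + Matrix.diagonal (fun i => MvPolynomial.X (κ i)) * K₀.map (fun a : ℂ => (MvPolynomial.C a : MvPolynomial σ ℂ))).det =
          (1 + Matrix.diagonal (fun i => MvPolynomial.X (κ₁ i)) * K₁.map (fun a : ℂ => (MvPolynomial.C a : MvPolynomial σ ℂ))).det := by
  intro R σ K₀ κ hκ hz
  obtain ⟨lam, hlam⟩ := exists_charpoly_eq_prod_X_sub_C K₀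
  -- one colour: at every point the diagonal of variables is a constant diagonal
  have hconst : ∀ x : σ → ℂ, ∃ t : ℂ, (fun i => x (κ i)) = fun _ : Fin R => t := by
    intro x
    rcases isEmpty_or_nonempty (Fin R) with hR | ⟨⟨i₀⟩⟩
    · exact ⟨0, funext fun i => isEmptyElim i⟩
    · exact ⟨x (κ i₀), funext fun i => congrArg x (hκ i i₀)⟩
  -- zero-freeness at the constant points `z ≡ t`, `|t| ≤ 2`
  have key : ∀ t : ℂ, ‖t‖ ≤ 2 → ∏ i, (1 + t * lam i) ≠ 0 := by
    intro t ht
    have h0 := hz (fun _ => t) (fun _ => ht)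
    rwa [eval_det_one_add_diagonal_mul_map_C, det_one_add_diagonal_const_mul_eq_prod K₀ hlam t]
      at h0
  refine ⟨Matrix.diagonal lam, κ, norm_toEuclideanCLM_diagonal_le lam (by norm_num)
    fun i => (norm_lt_half_of_prod_ne_zero key i).le, ?_⟩
  refine MvPolynomial.funext fun x => ?_
  obtain ⟨t, ht⟩ := hconst x
  rw [eval_det_one_add_diagonal_mul_map_C, eval_det_one_add_diagonal_mul_map_C, ht,
    det_one_add_diagonal_const_mul_eq_prod K₀ hlam t, det_one_add_diagonal_const_mul_diagonal]

end Summit.ValiantsHypothesis.ValiantsHypothesis.Theorems.PriceOfContractivity.SingleColour
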